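import Literature.AlgebraicGeometry.HodgeTheory.RealMultiplicationHodgeGroupEqLefschetz
import Literature.AlgebraicGeometry.HodgeTheory.RealMultiplicationRelDimTwoPowersHodgeClasses
import HarnessLib

/-!
# `Hg(A) = S(A)` and `MT(A) = L(A)` for a complex abelian variety whose endomorphism algebra is a totally real field `F` with `dim A = 2[F:ℚ]` (Moonen–Zarhin 1995 Type I(2) «`Hg = R_{F/ℚ} Sp_{4,F}`»; Milne 1999 Prop. 4.8) — unconditional; and HC_CM ⟹ HC(`A × C`) for `C` of CM type

Family `hodge`, layer `Literature/AlgebraicGeometry/HodgeTheory`. Research context: cell `pub-hodge-ring2`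
(HONEST FRAMING: research route conditional on HC_CM; not a corollary; Q11.4-sentence-2 already refuted in
dim ≥ 3), Literature lane gen 70, programme R47 — the group-theoretic reading of the divisoriality of all powers
in relative dimension TWO (`RealMultiplicationRelDimTwoPowersHodgeClasses`) through the tree's Milne lane
(`Milne1999/LefschetzGroup`, Prop. 4.8 (a) ⇒ (b), (c)), exactly as the relative-dimension-one file
`RealMultiplicationHodgeGroupEqLefschetz`. THEOREMS ONLY (no definition, no named fact; D-0026); §1 UNCONDITIONAL;
§2 CONDITIONAL on the binders `hCM` (the Hodge conjecture for CM abelian varieties, `Milne1999.CMHodgeHypothesisAt`)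
and `hL` (`Lombardo2016_hodgeClassesProductSpan`) — both ARGUMENTS, never asserted; no step towards a summit statement.

PUBLISHED STATEMENTS. Moonen–Zarhin 1995 (Duke 77), Type I(2): a simple abelian fourfold with `End⁰ = F` real
quadratic has `Hg = R_{F/ℚ} Sp_{4,F}` = the Lefschetz group; Milne 1999 Prop. 4.8 (p. 660): «no power of `A`
supports an exotic Hodge class ⟺ `Hg(A) = L(A)` ⟺ `Hg′(A) = S(A)`»; Moonen–Zarhin 1999 Thm. (3.2)(2) / Lombardo
2016 Lemma 3.4: Hodge classes on `A × C`, `A` without factors of type IV, `C` of CM type.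

MAIN RESULTS. §1 `AbelianVariety.hodgeGroup_eq_specialLefschetzGroup_of_isTotallyReal_of_two_mul_finrank_eq`,
`AbelianVariety.mumfordTateGroup_eq_lefschetzGroup_of_isTotallyReal_of_two_mul_finrank_eq` (unconditional);
§2 `hodgeConjectureFor_prod_cmType_of_isTotallyReal_of_two_mul_finrank_eq_of_cmHodgeHypothesis` (conditional).

## References

* [MoonenZarhin1995Duke] B. Moonen, Yu. Zarhin, Duke Math. J. 77 (1995), Type I(2). [cite: MoonenZarhin1995Duke, Type I(2)]
* [Milne1999LefschetzClasses] J. S. Milne, Duke Math. J. 96 (1999), Prop. 4.8 (p. 660). [cite: Milne1999LefschetzClasses, Prop. 4.8 (p. 660)]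
* [Murty1984] V. K. Murty, Math. Ann. 268 (1984), §3. [cite: Murty1984, §3]
* [Ribet1983] K. A. Ribet, Amer. J. Math. 105 (1983), Thm. 0. [cite: Ribet1983, Thm. 0]
* [MoonenZarhin1999LowDim] B. Moonen, Yu. Zarhin, Math. Ann. 315 (1999), §1 and Thm. (3.2). [cite: MoonenZarhin1999LowDim, §1 and Thm. (3.2)]
* [Lombardo2016] D. Lombardo, Ann. Inst. Fourier 66 (2016), Lemma 3.4 (p. 1229). [cite: Lombardo2016, Lemma 3.4 (p. 1229)]
-/

noncomputable section

open CategoryTheory Module NumberField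

namespace Literature.AlgebraicGeometry.HodgeTheory

open Literature.AlgebraicGeometry.Motives (AbelianVariety)
open Literature.AlgebraicGeometry.ComplexMultiplication
open Literature.AlgebraicGeometry.Milne1999

/-! ### §1 `Hg′(A) = S(A)` and `Hg(A) = L(A)` in relative dimension two — unconditional -/

/-- **`Hg′(A) = S(A)` (Milne Prop. 4.8 (c); Moonen–Zarhin Type I(2) `Hg(A) = R_{F/ℚ} Sp_{4,F} = Lef(A)`) for a complex
abelian variety whose endomorphism algebra is a totally real field `F` with `2[F:ℚ] = dim A`** — unconditional: all
powers are divisorial (`AbelianVariety.isDivisorGenerated_powSucc_of_isTotallyReal_of_two_mul_finrank_eq`) and Milne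
Prop. 4.8 (a) ⇒ (c) (`AbelianVariety.hodgeGroup_eq_specialLefschetzGroup_of_forall_isDivisorGenerated`).
[cite: MoonenZarhin1995Duke, Type I(2)] [cite: Milne1999LefschetzClasses, Prop. 4.8 (p. 660)] [cite: Murty1984, §3] -/
theorem AbelianVariety.hodgeGroup_eq_specialLefschetzGroup_of_isTotallyReal_of_two_mul_finrank_eq
    (A : AbelianVariety ℂ) (hF : IsField A.endAlgebra) [IsTotallyReal (EndField A hF)]
    (hdeg : 2 * Module.finrank ℚ A.endAlgebra = A.dim) :
    hodgeGroup A.dim A.X = specialLefschetzGroup A.dim A.X :=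
  Motives.AbelianVariety.hodgeGroup_eq_specialLefschetzGroup_of_forall_isDivisorGenerated A
    fun a => AbelianVariety.isDivisorGenerated_powSucc_of_isTotallyReal_of_two_mul_finrank_eq A hF hdeg a

/-- **`Hg(A) = L(A)` (Milne Prop. 4.8 (b): the Mumford–Tate group is the Lefschetz group) for a complex abelian
variety whose endomorphism algebra is a totally real field `F` with `2[F:ℚ] = dim A`** — unconditional.
[cite: Milne1999LefschetzClasses, Prop. 4.8 (p. 660)] [cite: MoonenZarhin1995Duke, Type I(2)] -/
theorem AbelianVariety.mumfordTateGroup_eq_lefschetzGroup_of_isTotallyReal_of_two_mul_finrank_eq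
    (A : AbelianVariety ℂ) (hF : IsField A.endAlgebra) [IsTotallyReal (EndField A hF)]
    (hdeg : 2 * Module.finrank ℚ A.endAlgebra = A.dim) :
    mumfordTateGroup A.dim A.X = lefschetzGroup A.dim A.X :=
  Motives.AbelianVariety.mumfordTateGroup_eq_lefschetzGroup_of_forall_isDivisorGenerated A
    fun a => AbelianVariety.isDivisorGenerated_powSucc_of_isTotallyReal_of_two_mul_finrank_eq A hF hdeg a

/-! ### §2 HC_CM ⟹ HC(`A × C`) for `C` of CM type — conditional -/

/-- **HC_CM ∧ (Lombardo–Moonen–Zarhin span) ⟹ HC(`A × C`) for `A` with `End⁰(A)` a totally real field `F`,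
`2[F:ℚ] = dim A`, and `C` of CM type** (ring 2, route `motiv`, HONEST FRAMING: research route conditional on HC_CM;
not a corollary; Q11.4-sentence-2 already refuted in dim ≥ 3): the tree's `hodgeConjectureFor_prod_of_cmHodgeHypothesis`
with HC(`A`) DISCHARGED by `AbelianVariety.isDivisorGenerated_of_isTotallyReal_of_two_mul_finrank_eq` and
`HasNoTypeIVFactor A` by `hasNoTypeIVFactor_of_isTotallyReal`; the binders `hCM` and `hL` remain ARGUMENTS.
[cite: MoonenZarhin1999LowDim, Thm. (3.2)] [cite: Lombardo2016, Lemma 3.4 (p. 1229)] [cite: MoonenZarhin1995Duke, Type I(2)] -/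
theorem hodgeConjectureFor_prod_cmType_of_isTotallyReal_of_two_mul_finrank_eq_of_cmHodgeHypothesis
    (hCM : ∀ B : AbelianVariety ℂ, Milne1999.CMHodgeHypothesisAt B)
    (hL : Lombardo2016_hodgeClassesProductSpan) (A C : AbelianVariety ℂ) (hF : IsField A.endAlgebra)
    [IsTotallyReal (EndField A hF)] (hdeg : 2 * Module.finrank ℚ A.endAlgebra = A.dim)
    (hCt : Milne1999.IsOfCMType C) : HodgeConjectureFor (A.prod C).dim (A.prod C).X :=
  hodgeConjectureFor_prod_of_cmHodgeHypothesis hCM hL A C (hasNoTypeIVFactor_of_isTotallyReal A hF) hCt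
    (hodgeConjectureFor_of_isDivisorGenerated A
      (AbelianVariety.isDivisorGenerated_of_isTotallyReal_of_two_mul_finrank_eq A hF hdeg))

end Literature.AlgebraicGeometry.HodgeTheory

end
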